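import Summits.QuantumFields.BalabanUV.T4Continuum.Support.ShellMeasureDecaySignedRemainder
import Summits.QuantumFields.BalabanUV.Beta.MultiscaleDecayDirichlet

/-!
# `T4Continuum.ShellMeasureDecaySignedRemainderCov` — THE (81)-PERTURBATION BOOKKEEPING, file 2: the COVARIANT instance of the signed
# END under a per-cube (3.35)-shape gauge, the witness that the SIGNED clause is inhabited by a remainder outside J6's (a strictly
# NEGATIVE diagonal of local-gap size), and the SECTIONED twin (`Ω₀·levelOp·Ω₀ + (1 − Ω₀) + P`, every domain)
(cell `pub-balaban`, sub-cell `t4`, spine estimate NE7c (node U5b); NE7c ROUND-2 crew `t4-ne7c-formalise-*`, unit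
`b2b-balaban-t4-ne7c-formalise-leaf-05` gen 13; journal INTENT I-ne7cL05g13-1 (2026-08-21, l.25065) → OFFER to the owner (post-v6 ESTIMATE
LANE; R-ne7cp1-g37-13: filed only on the owner's word); file 2∕2 — imports file 1 `ShellMeasureDecaySignedRemainder` + `Beta/MultiscaleDecayDirichlet`
(`hc_sandwich`, beta-d4-p2) ONLY and touches NO host; [folklore]; 0 `def`, 0 `def … : Prop`, 0 sorry, 0 citation tags of Bałaban's.)

HONEST FRAMING.  Finite four-torus programme, rung (B)+1 only — NOT infinite volume, NOT a mass gap, NOT the Clay problem, NOT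
summit progress.  NE7c (`T4IndicatorShell.ShellWeightBound`) is NOT PRINTED in [Balaban 1983–89] and NOT PROVED; «NE7c ⇐ the named
binders» (trigger c3).  Lemmas of OURS about the MODEL operator `levelOp` ([Balaban1985BackgroundPropagators] (3.24) SHAPE); the gauge
datum `g hg ε hε hgauge hloss` is the `Beta/MultiscaleCoerciveTorusCov` END's own hypothesis (E7's species via ROW S119 = J4, not
discharged here); nothing says that Bałaban's `Δ₁ + D^*RD + aQ^*Q` IS `levelOp + P` (node O).  No END host is touched; census COUNT
unchanged; nothing of Bałaban's asserted, cited or discharged.  HONEST DEPENDENCY (cell): continuum YM on T⁴ ⇐ BetaPertH ∧ nine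
spine estimates (0/9 proved); BetaPertH ⇐ (D1) ∧ (D4) ∧ CAP+tail; G-an2-4 gates asym, D1 and NE2/3/4.

CONTENT.  §1 **`decay_levelOp_add_signedLocal_cov`** = `MultiscaleDecay.decay_levelOp_cov`'s binders + `P r hPsupp hProw hPcol hsmall` ⟹
`IsUnit (cmat levelOp + P) ∧ ‖(cmat levelOp + P)⁻¹ p q‖ ≤ e^{−κ·d_n}·n(p₁)n(q₁)∕(μ₀ − β·e^{κr})`, `μ₀ = (1 − θ_g)·min(c_min²∕(4d), a_min∕4) −
2d·c_max²κ² − a_max(e^{2dκ} − 1)` (the `U = 1` instance is the same one-liner over `multiscale_coercive_torus_flat`).  §2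
**`decay_levelOp_sub_localGap`** — for every inhabitant of the `Beta/` END's family and every `0 ≤ β < μ₀`, the remainder
`P := −β·diag(n(e₁)⁻²)` (strictly negative on `z ≠ 0`, so NOT in the scope of J6's `hP : 0 ≤ Re z^*Pz`; `d_n`-range `0`, sitewise
absolute row = column sums `β·n⁻²`) fires file 1's END with denominator `μ₀ − β` — joint inhabitation of the new binders
`hPsupp hProw hPcol hsmall` by a NONZERO signed remainder (crew rule G-1 for file 1's own binders; the family itself is inhabited by
ROW S116 (b) ∕ S117 ∕ S118 f3).  §3 THE SECTIONED TWIN (the u-tuple's propagators are SECTIONED — [B9]'s `Ω₀Δ′_aΩ₀`, the `dirInv`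
currency of `Beta/MultiscaleDecayDirichlet` ∕ ROW S118 f2 ∕ J6 f3): **`decay_sandwich_add_signed`** = `MultiscaleDecayDirichlet.decay_dirInv_levelOp`'s
binders (… `χ hχ`) + `P θ θ′ hθ hPform hJ` against the profile `min(μ₀,1)·n⁻²` ⟹ `cmat (Ω₀·levelOp·Ω₀ + (1 − Ω₀)) + P` is a unit with
entries `≤ e^{−κ·d_n}·n(p)n(q)∕((1 − θ − θ′)·min(μ₀,1))`; **`decay_sandwich_add_signedLocal`** = the same from `r β hPsupp hProw hPcol` and
`β·e^{κr} < min(μ₀,1)`, denominator `min(μ₀,1) − β·e^{κr}` (file 1's `budgets_of_signedLocal` at `m := min(μ₀,1)`).  NOT claimed: the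
entry cut `χ(p)χ(q)` of `dirInv` proper (one line for the consumer, as in J6 f3); sup∕cell members; any bound on Bałaban's remainder.
-/

noncomputable section

open scoped BigOperators Matrix ComplexConjugate
open Finset Function Complex Matrix

namespace Summit.QuantumFields.BalabanUV.T4Continuum.ShellMeasureDecaySignedRemainderCov

open Summit.QuantumFields.BalabanUV.Beta
open Summit.QuantumFields.BalabanUV.Beta.BoxPoincare (Box)
open Summit.QuantumFields.BalabanUV.Beta.CovariantBoxPoincare (hol)
open Summit.QuantumFields.BalabanUV.Beta.MultiscaleCoerciveTorus
open Summit.QuantumFields.BalabanUV.Beta.MultiscaleCoerciveTorusCov (multiscale_coercive_torus_cov)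
open Summit.QuantumFields.BalabanUV.Beta.MultiscaleDecayBudget (siteScale one_le_siteScale)
open Summit.QuantumFields.BalabanUV.Beta.MultiscaleDistance (sdist sdist_self)
open Summit.QuantumFields.BalabanUV.Beta.CovariantTowerMatrix (cmat)
open Summit.QuantumFields.BalabanUV.Beta.MultiscaleDecayDirichlet (hc_sandwich)
open Summit.QuantumFields.BalabanUV.Beta.AccretiveCombesThomas (conjForm)
open Summit.QuantumFields.BalabanUV.Beta.AccretiveCombesThomasBudget (expRowDefect expColDefect)
open Summit.QuantumFields.BalabanUV.Beta.MultiscaleCombesThomasBudget (localConjCoercive_of_real realConjForm realConjForm_toMatrix')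
open Summit.QuantumFields.BalabanUV.T4Continuum.ShellMeasureDecaySignedRemainder (decay_levelOp_add_signedLocal
  norm_inv_add_le_local_of_lowerBounded budgets_of_signedLocal)
open Literature.MathematicalPhysics.QuantumFieldTheory.Balaban1983to89.B9Thm37Sum (mulOp)
open Literature.MathematicalPhysics.QuantumFieldTheory.Balaban1983to89
open Literature.MathematicalPhysics.QuantumFieldTheory.Balaban1983to89.B9Thm37GluePU (bsrc btgt)
open Literature.MathematicalPhysics.QuantumFieldTheory.Balaban1983to89.B9Thm37GlueTorusCov (tblk torusComb)
open Literature.MathematicalPhysics.QuantumFieldTheory.Balaban1983to89.B9Thm37GlueTorusCovLevels (levelOp)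
open B5TorusCover (UT Ctr ctrU)

/-! ## §1 The COVARIANT instance of `MultiscaleDecay` §3 with a signed local remainder -/

section Instances

variable {d : ℕ} {N : Fin d → ℕ} [∀ i, NeZero (N i)] [NeZero d] {Cp J K : Type} [Fintype Cp] [DecidableEq Cp] [Fintype J] [Fintype K]
  (S : J → ℕ) (hS : ∀ l, 1 ≤ S l) (hdivS : ∀ l i, S l ∣ N i) (lvl : K → J) (zc : (k : K) → Ctr N (S (lvl k)))

/-- **Signed local remainder, COVARIANT under a per-cube (3.35)-shape gauge** (`MultiscaleDecay.decay_levelOp_cov`'s setting +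
`P r β hPsupp hProw hPcol hsmall`; `C = (1 − θ_g)·min(c_min²∕(4d), a_min∕4)` with the gauge loss `θ_g`). [folklore] -/
theorem decay_levelOp_add_signedLocal_cov
    (hdisj : ∀ k k' v v', cellPt S hS hdivS lvl zc k v = cellPt S hS hdivS lvl zc k' v' → k = k')
    (hcover : ∀ x : UT N, ∃ k, ∃ v : Box d (S (lvl k)), cellPt S hS hdivS lvl zc k v = x)
    (Rm : UT N × Fin d → Cp → Cp → ℝ) (hRm : ∀ b i j, ∑ k, Rm b k i * Rm b k j = if i = j then (1 : ℝ) else 0)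
    (a : J → ℝ) (ha : ∀ j, 0 ≤ a j) (ω : J → UT N → ℝ)
    (hsupp : ∀ l x, ω l (ctrU N (S l) (tblk (hS l) (hdivS l) x)) ≠ 0 → ∃ k v, lvl k = l ∧ cellPt S hS hdivS lvl zc k v = x)
    {amin amax : ℝ} (hamin : 0 ≤ amin) (hamax : 0 ≤ amax)
    (hscale_lo : ∀ k, amin / (S (lvl k) : ℝ) ^ 2 ≤ a (lvl k) * ω (lvl k) (ctrU N (S (lvl k)) (zc k)) ^ 2 * (S (lvl k) : ℝ) ^ d)
    (hscale_hi : ∀ k, a (lvl k) * ω (lvl k) (ctrU N (S (lvl k)) (zc k)) ^ 2 * (S (lvl k) : ℝ) ^ d ≤ amax / (S (lvl k) : ℝ) ^ 2)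
    (c : UT N × Fin d → ℝ) {cmin cmax : ℝ} (hcmin : 0 < cmin) (hc_lo : ∀ b, cmin ≤ |c b|) (hc_hi : ∀ b, |c b| ≤ cmax)
    (g : (k : K) → Box d (S (lvl k)) → Cp → Cp → ℝ)
    (hg : ∀ k v i i', ∑ k', g k v k' i * g k v k' i' = if i = i' then (1 : ℝ) else 0) (ε : K → ℝ) (hε : ∀ k, 0 ≤ ε k)
    (hgauge : ∀ k (v : Box d (S (lvl k))) (i : Fin d) (hv : (v i : ℕ) + 1 < S (lvl k)) (u : Cp → ℝ),
      ∑ a', (∑ j, (hol Rm (g k) (fun v i _ => (cellPt S hS hdivS lvl zc k v, i)) v i hv a' j -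
        if a' = j then 1 else 0) * u j) ^ 2 ≤ ε k ^ 2 * ∑ j, u j ^ 2)
    {θg : ℝ} (hloss : ∀ k, 4 * ((d : ℝ) * (S (lvl k)) * ((S (lvl k) : ℝ) - 1)) * d * ε k ^ 2 +
      4 * ((d * (S (lvl k) - 1) : ℕ) * ε k) ^ 2 ≤ θg)
    {κ : ℝ} (hκ0 : 0 ≤ κ) (hκ1 : κ ≤ 1)
    (hμ : 0 < (1 - θg) * min (cmin ^ 2 / (4 * d)) (amin / 4) - 2 * d * cmax ^ 2 * κ ^ 2 - amax * (Real.exp (2 * d * κ) - 1))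
    (P : Matrix (UT N × Cp) (UT N × Cp) ℂ) {r β : ℝ} (hr : 0 ≤ r)
    (hPsupp : ∀ e e' : UT N × Cp, P e e' ≠ 0 → sdist bsrc btgt (siteScale S hS hdivS lvl zc hcover) e.1 e'.1 ≤ r)
    (hProw : ∀ e : UT N × Cp, ∑ e', ‖P e e'‖ ≤ β * ((siteScale S hS hdivS lvl zc hcover e.1 : ℝ) ^ 2)⁻¹)
    (hPcol : ∀ e' : UT N × Cp, ∑ e, ‖P e e'‖ ≤ β * ((siteScale S hS hdivS lvl zc hcover e'.1 : ℝ) ^ 2)⁻¹)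
    (hsmall : β * Real.exp (κ * r) <
      (1 - θg) * min (cmin ^ 2 / (4 * d)) (amin / 4) - 2 * d * cmax ^ 2 * κ ^ 2 - amax * (Real.exp (2 * d * κ) - 1))
    (p q : UT N × Cp) :
    IsUnit (cmat (levelOp bsrc btgt c Rm (fun l x => ctrU N (S l) (tblk (hS l) (hdivS l) x))
        (fun l x => ω l (ctrU N (S l) (tblk (hS l) (hdivS l) x))) (fun l x => (torusComb (hS l) (hdivS l)).tr Rm x) a) + P) ∧
      ‖(cmat (levelOp bsrc btgt c Rm (fun l x => ctrU N (S l) (tblk (hS l) (hdivS l) x))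
          (fun l x => ω l (ctrU N (S l) (tblk (hS l) (hdivS l) x))) (fun l x => (torusComb (hS l) (hdivS l)).tr Rm x) a) + P)⁻¹
          p q‖ ≤
        Real.exp (-(κ * sdist bsrc btgt (siteScale S hS hdivS lvl zc hcover) p.1 q.1)) *
          ((siteScale S hS hdivS lvl zc hcover p.1 : ℝ) * (siteScale S hS hdivS lvl zc hcover q.1 : ℝ)) /
          ((1 - θg) * min (cmin ^ 2 / (4 * d)) (amin / 4) - 2 * d * cmax ^ 2 * κ ^ 2 - amax * (Real.exp (2 * d * κ) - 1) -
            β * Real.exp (κ * r)) :=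
  decay_levelOp_add_signedLocal S hS hdivS lvl zc hdisj hcover Rm hRm (fun l x => (torusComb (hS l) (hdivS l)).tr Rm x)
    (fun l x i i' => (torusComb (hS l) (hdivS l)).tr_orth Rm hRm x i i') a ha ω hsupp hamax hscale_hi c hc_hi
    (fun f => multiscale_coercive_torus_cov (Nat.one_le_iff_ne_zero.mpr (NeZero.ne d)) S hS hdivS Rm hRm a ha ω c hcmin hc_lo lvl zc
      hdisj hamin hscale_lo g hg ε hε hgauge hloss f)
    hκ0 hκ1 hμ P hr hPsupp hProw hPcol hsmall p q

end Instances

/-! ## §2 The SIGNED case is inhabited by a remainder outside J6's clause: a strictly NEGATIVE diagonal of local-gap size -/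

section Negative

variable {d : ℕ} {N : Fin d → ℕ} [∀ i, NeZero (N i)] [NeZero d] {Cp J K : Type} [Fintype Cp] [DecidableEq Cp] [Fintype J] [Fintype K]
  (S : J → ℕ) (hS : ∀ l, 1 ≤ S l) (hdivS : ∀ l i, S l ∣ N i) (lvl : K → J) (zc : (k : K) → Ctr N (S (lvl k)))

/-- **A NEGATIVE LOCAL-GAP SHIFT DOES NOT SPOIL E1∕E6 (MODEL).**  In `MultiscaleDecay.decay_levelOp`'s setting, for every
`0 ≤ β < μ₀` the remainder `P := −β·diag(n(e₁)⁻²)` — strictly negative on `z ≠ 0`, so NOT in the scope of J6's `hP : 0 ≤ Re z^*Pz`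
— has `d_n`-range `0` and sitewise absolute row = column sums `β·n⁻²`; the signed END fires:
`‖(cmat levelOp − β·diag(n⁻²))⁻¹(p,q)‖ ≤ e^{−κ·d_n(p,q)}·n(p)n(q)∕(μ₀ − β)`.  (Joint inhabitation of the new binders
`hPsupp hProw hPcol hsmall` by a NONZERO remainder over ANY inhabitant of the `Beta/` END's family — crew rule G-1 for this file's
own binders; the family itself is inhabited by ROW S116 (b) ∕ S117.) [folklore] -/
theorem decay_levelOp_sub_localGap
    (hdisj : ∀ k k' v v', cellPt S hS hdivS lvl zc k v = cellPt S hS hdivS lvl zc k' v' → k = k')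
    (hcover : ∀ x : UT N, ∃ k, ∃ v : Box d (S (lvl k)), cellPt S hS hdivS lvl zc k v = x)
    (Rm : UT N × Fin d → Cp → Cp → ℝ) (hRm : ∀ b i j, ∑ k, Rm b k i * Rm b k j = if i = j then (1 : ℝ) else 0)
    (T : J → UT N → Cp → Cp → ℝ) (hT : ∀ l x i i', ∑ k, T l x k i * T l x k i' = if i = i' then (1 : ℝ) else 0)
    (a : J → ℝ) (ha : ∀ j, 0 ≤ a j) (ω : J → UT N → ℝ)
    (hsupp : ∀ l x, ω l (ctrU N (S l) (tblk (hS l) (hdivS l) x)) ≠ 0 → ∃ k v, lvl k = l ∧ cellPt S hS hdivS lvl zc k v = x)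
    {amax : ℝ} (hamax : 0 ≤ amax)
    (hscale : ∀ k, a (lvl k) * ω (lvl k) (ctrU N (S (lvl k)) (zc k)) ^ 2 * (S (lvl k) : ℝ) ^ d ≤ amax / (S (lvl k) : ℝ) ^ 2)
    (c : UT N × Fin d → ℝ) {cmax : ℝ} (hc : ∀ b, |c b| ≤ cmax) {C : ℝ}
    (hcoer : ∀ f : UT N × Cp → ℝ,
      C * ∑ k, ((S (lvl k) : ℝ) ^ 2)⁻¹ * ∑ v : Box d (S (lvl k)), ∑ i, f (cellPt S hS hdivS lvl zc k v, i) ^ 2 ≤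
        ∑ p, f p * levelOp bsrc btgt c Rm (fun l x => ctrU N (S l) (tblk (hS l) (hdivS l) x))
          (fun l x => ω l (ctrU N (S l) (tblk (hS l) (hdivS l) x))) T a f p)
    {κ : ℝ} (hκ0 : 0 ≤ κ) (hκ1 : κ ≤ 1) (hμ : 0 < C - 2 * d * cmax ^ 2 * κ ^ 2 - amax * (Real.exp (2 * d * κ) - 1))
    {β : ℝ} (hβ : 0 ≤ β) (hβμ : β < C - 2 * d * cmax ^ 2 * κ ^ 2 - amax * (Real.exp (2 * d * κ) - 1))
    (p q : UT N × Cp) :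
    IsUnit (cmat (levelOp bsrc btgt c Rm (fun l x => ctrU N (S l) (tblk (hS l) (hdivS l) x))
        (fun l x => ω l (ctrU N (S l) (tblk (hS l) (hdivS l) x))) T a) +
        -Matrix.diagonal (fun e : UT N × Cp => ((β * ((siteScale S hS hdivS lvl zc hcover e.1 : ℝ) ^ 2)⁻¹ : ℝ) : ℂ))) ∧
      ‖(cmat (levelOp bsrc btgt c Rm (fun l x => ctrU N (S l) (tblk (hS l) (hdivS l) x))
          (fun l x => ω l (ctrU N (S l) (tblk (hS l) (hdivS l) x))) T a) +
          -Matrix.diagonal (fun e : UT N × Cp => ((β * ((siteScale S hS hdivS lvl zc hcover e.1 : ℝ) ^ 2)⁻¹ : ℝ) : ℂ)))⁻¹ p q‖ ≤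
        Real.exp (-(κ * sdist bsrc btgt (siteScale S hS hdivS lvl zc hcover) p.1 q.1)) *
          ((siteScale S hS hdivS lvl zc hcover p.1 : ℝ) * (siteScale S hS hdivS lvl zc hcover q.1 : ℝ)) /
          (C - 2 * d * cmax ^ 2 * κ ^ 2 - amax * (Real.exp (2 * d * κ) - 1) - β) := by
  classical
  set n := siteScale S hS hdivS lvl zc hcover with hn
  set P : Matrix (UT N × Cp) (UT N × Cp) ℂ :=
    -Matrix.diagonal (fun e : UT N × Cp => ((β * ((n e.1 : ℝ) ^ 2)⁻¹ : ℝ) : ℂ)) with hP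
  have hn0 : ∀ x, (0 : ℝ) < n x := fun x => by exact_mod_cast one_le_siteScale S hS hdivS lvl zc hcover x
  -- entries of `P`
  have hPe : ∀ e e' : UT N × Cp, P e e' = if e = e' then -(((β * ((n e.1 : ℝ) ^ 2)⁻¹ : ℝ) : ℂ)) else 0 := by
    intro e e'
    rw [hP, Matrix.neg_apply, Matrix.diagonal_apply]
    split_ifs <;> simp
  have hnormdiag : ∀ e : UT N × Cp, ‖P e e‖ = β * ((n e.1 : ℝ) ^ 2)⁻¹ := by
    intro e
    rw [hPe, if_pos rfl, norm_neg, Complex.norm_real, Real.norm_eq_abs,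
      abs_of_nonneg (mul_nonneg hβ (inv_nonneg.mpr (sq_nonneg _)))]
  have hsum_row : ∀ e : UT N × Cp, ∑ e', ‖P e e'‖ = β * ((n e.1 : ℝ) ^ 2)⁻¹ := by
    intro e
    rw [Finset.sum_eq_single e (fun e' _ he' => by rw [hPe, if_neg (Ne.symm he'), norm_zero])
      (fun h => absurd (Finset.mem_univ e) h), hnormdiag]
  have hsum_col : ∀ e' : UT N × Cp, ∑ e, ‖P e e'‖ = β * ((n e'.1 : ℝ) ^ 2)⁻¹ := by
    intro e'
    rw [Finset.sum_eq_single e' (fun e _ he => by rw [hPe, if_neg he, norm_zero])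
      (fun h => absurd (Finset.mem_univ e') h), hnormdiag]
  have hPsupp : ∀ e e' : UT N × Cp, P e e' ≠ 0 → sdist bsrc btgt n e.1 e'.1 ≤ 0 := by
    intro e e' hne
    by_cases h : e = e'
    · subst h
      rw [sdist_self]
    · exact absurd (by rw [hPe, if_neg h]) hne
  have hsmall : β * Real.exp (κ * 0) < C - 2 * d * cmax ^ 2 * κ ^ 2 - amax * (Real.exp (2 * d * κ) - 1) := by
    rw [mul_zero, Real.exp_zero, mul_one]
    exact hβμ
  have h := decay_levelOp_add_signedLocal S hS hdivS lvl zc hdisj hcover Rm hRm T hT a ha ω hsupp hamax hscale c hc hcoer hκ0 hκ1 hμ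
    P le_rfl hPsupp (fun e => (hsum_row e).le) (fun e' => (hsum_col e').le) hsmall p q
  rw [mul_zero, Real.exp_zero, mul_one] at h
  exact h

end Negative

/-! ## §3 The SECTIONED twin: `Ω₀·levelOp·Ω₀ + (1 − Ω₀)` with a signed remainder, every domain -/

section Sandwich

variable {d : ℕ} {N : Fin d → ℕ} [∀ i, NeZero (N i)] [NeZero d] {Cp J K : Type} [Fintype Cp] [DecidableEq Cp] [Fintype J] [Fintype K]
  (S : J → ℕ) (hS : ∀ l, 1 ≤ S l) (hdivS : ∀ l i, S l ∣ N i) (lvl : K → J) (zc : (k : K) → Ctr N (S (lvl k)))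

/-- **THE SECTIONED OPERATOR WITH A SIGNED REMAINDER, BUDGETS DISPLAYED (MODEL; every domain).**  Setting of
`MultiscaleDecayDirichlet.decay_dirInv_levelOp` (torus, covering disjoint cube family, isometric `Rm`, `T`, print-size weights from above,
`|c| ≤ c_max`, cell-sum coercivity `C`, `0 ≤ κ ≤ 1`, `μ₀ > 0`, a `{0,1}`-valued `χ`) + a complex remainder `P` with the form budget
`−θ′·Σ_e min(μ₀,1)·n(e₁)⁻²‖z_e‖² ≤ Re z^*Pz` and the sitewise defect budget `θ·min(μ₀,1)·n(e₁)⁻²`, `θ + θ′ < 1`.  Then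
`cmat (Ω₀·levelOp·Ω₀ + (1 − Ω₀)) + P` is a unit and `‖(…)⁻¹(p,q)‖ ≤ e^{−κ·d_n(p,q)}·n(p)n(q)∕((1 − θ − θ′)·min(μ₀,1))`. [folklore] -/
theorem decay_sandwich_add_signed
    (hdisj : ∀ k k' v v', cellPt S hS hdivS lvl zc k v = cellPt S hS hdivS lvl zc k' v' → k = k')
    (hcover : ∀ x : UT N, ∃ k, ∃ v : Box d (S (lvl k)), cellPt S hS hdivS lvl zc k v = x)
    (Rm : UT N × Fin d → Cp → Cp → ℝ) (hRm : ∀ b i j, ∑ k, Rm b k i * Rm b k j = if i = j then (1 : ℝ) else 0)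
    (T : J → UT N → Cp → Cp → ℝ) (hT : ∀ l x i i', ∑ k, T l x k i * T l x k i' = if i = i' then (1 : ℝ) else 0)
    (a : J → ℝ) (ha : ∀ j, 0 ≤ a j) (ω : J → UT N → ℝ)
    (hsupp : ∀ l x, ω l (ctrU N (S l) (tblk (hS l) (hdivS l) x)) ≠ 0 → ∃ k v, lvl k = l ∧ cellPt S hS hdivS lvl zc k v = x)
    {amax : ℝ} (hamax : 0 ≤ amax)
    (hscale : ∀ k, a (lvl k) * ω (lvl k) (ctrU N (S (lvl k)) (zc k)) ^ 2 * (S (lvl k) : ℝ) ^ d ≤ amax / (S (lvl k) : ℝ) ^ 2)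
    (c : UT N × Fin d → ℝ) {cmax : ℝ} (hc : ∀ b, |c b| ≤ cmax) {C : ℝ}
    (hcoer : ∀ f : UT N × Cp → ℝ,
      C * ∑ k, ((S (lvl k) : ℝ) ^ 2)⁻¹ * ∑ v : Box d (S (lvl k)), ∑ i, f (cellPt S hS hdivS lvl zc k v, i) ^ 2 ≤
        ∑ p, f p * levelOp bsrc btgt c Rm (fun l x => ctrU N (S l) (tblk (hS l) (hdivS l) x))
          (fun l x => ω l (ctrU N (S l) (tblk (hS l) (hdivS l) x))) T a f p)
    {κ : ℝ} (hκ0 : 0 ≤ κ) (hκ1 : κ ≤ 1) (hμ : 0 < C - 2 * d * cmax ^ 2 * κ ^ 2 - amax * (Real.exp (2 * d * κ) - 1))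
    (χ : UT N × Cp → ℝ) (hχ : ∀ p, χ p = 0 ∨ χ p = 1)
    (P : Matrix (UT N × Cp) (UT N × Cp) ℂ) {θ θ' : ℝ} (hθ : θ + θ' < 1)
    (hPform : ∀ z : UT N × Cp → ℂ,
      -(θ' * ∑ e, min (C - 2 * d * cmax ^ 2 * κ ^ 2 - amax * (Real.exp (2 * d * κ) - 1)) 1 *
          ((siteScale S hS hdivS lvl zc hcover e.1 : ℝ) ^ 2)⁻¹ * ‖z e‖ ^ 2) ≤ (star z ⬝ᵥ (P *ᵥ z)).re)
    (hJ : ∀ q e : UT N × Cp,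
      (expRowDefect P κ (fun e => sdist bsrc btgt (siteScale S hS hdivS lvl zc hcover) e.1 q.1) e +
          expColDefect P κ (fun e => sdist bsrc btgt (siteScale S hS hdivS lvl zc hcover) e.1 q.1) e) / 2 ≤
        θ * (min (C - 2 * d * cmax ^ 2 * κ ^ 2 - amax * (Real.exp (2 * d * κ) - 1)) 1 *
          ((siteScale S hS hdivS lvl zc hcover e.1 : ℝ) ^ 2)⁻¹))
    (p q : UT N × Cp) :
    IsUnit (cmat (mulOp χ * levelOp bsrc btgt c Rm (fun l x => ctrU N (S l) (tblk (hS l) (hdivS l) x))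
          (fun l x => ω l (ctrU N (S l) (tblk (hS l) (hdivS l) x))) T a * mulOp χ + mulOp (1 - χ) :
        Module.End ℝ (UT N × Cp → ℝ)) + P) ∧
      ‖(cmat (mulOp χ * levelOp bsrc btgt c Rm (fun l x => ctrU N (S l) (tblk (hS l) (hdivS l) x))
            (fun l x => ω l (ctrU N (S l) (tblk (hS l) (hdivS l) x))) T a * mulOp χ + mulOp (1 - χ) :
          Module.End ℝ (UT N × Cp → ℝ)) + P)⁻¹ p q‖ ≤
        Real.exp (-(κ * sdist bsrc btgt (siteScale S hS hdivS lvl zc hcover) p.1 q.1)) *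
          ((siteScale S hS hdivS lvl zc hcover p.1 : ℝ) * (siteScale S hS hdivS lvl zc hcover q.1 : ℝ)) /
          ((1 - θ - θ') * min (C - 2 * d * cmax ^ 2 * κ ^ 2 - amax * (Real.exp (2 * d * κ) - 1)) 1) := by
  classical
  set n := siteScale S hS hdivS lvl zc hcover with hn
  set Sw := (mulOp χ * levelOp bsrc btgt c Rm (fun l x => ctrU N (S l) (tblk (hS l) (hdivS l) x))
      (fun l x => ω l (ctrU N (S l) (tblk (hS l) (hdivS l) x))) T a * mulOp χ + mulOp (1 - χ) :
    Module.End ℝ (UT N × Cp → ℝ)) with hSw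
  set m₀ := min (C - 2 * d * cmax ^ 2 * κ ^ 2 - amax * (Real.exp (2 * d * κ) - 1)) 1 with hm₀
  have hm : 0 < m₀ := lt_min hμ zero_lt_one
  have hn0 : ∀ x, (0 : ℝ) < n x := fun x => by exact_mod_cast one_le_siteScale S hS hdivS lvl zc hcover x
  set μ : UT N × Cp → ℝ := fun e => m₀ * ((n e.1 : ℝ) ^ 2)⁻¹ with hμdef
  have hμpos : ∀ e, 0 < μ e := fun e => mul_pos hm (inv_pos.mpr (pow_pos (hn0 e.1) 2))
  set dd : UT N × Cp → UT N × Cp → ℝ := fun e e' => sdist bsrc btgt n e.1 e'.1 with hdd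
  have hd0 : ∀ j, dd j j = 0 := fun j => sdist_self bsrc btgt n j.1
  have hcR : ∀ j, ∀ w : UT N × Cp → ℝ, ∑ e, μ e * w e ^ 2 ≤ realConjForm (LinearMap.toMatrix' Sw) κ (fun e => dd e j) w := by
    intro j w
    rw [realConjForm_toMatrix']
    have h := hc_sandwich S hS hdivS lvl zc hdisj hcover Rm hRm T hT a ha ω hsupp hamax hscale c hc hcoer hκ0 hκ1 χ hχ j w
    refine le_trans (le_of_eq (Finset.sum_congr rfl fun e _ => ?_)) h
    rw [hμdef]
  have hcA : ∀ j, ∀ z : UT N × Cp → ℂ, ∑ e, μ e * ‖z e‖ ^ 2 ≤ (conjForm (cmat Sw) κ (fun e => dd e j) z).re :=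
    fun j z => localConjCoercive_of_real _ (hcR j) z
  have hP' : ∀ z : UT N × Cp → ℂ, -(θ' * ∑ e, μ e * ‖z e‖ ^ 2) ≤ (star z ⬝ᵥ (P *ᵥ z)).re := fun z => hPform z
  have hEND := norm_inv_add_le_local_of_lowerBounded (cmat Sw) P dd hd0 hκ0 hμpos hθ hcA hP' (fun j e => hJ j e) p q
  refine ⟨hEND.1, ?_⟩
  have hsqrt : Real.sqrt (μ p * μ q) = m₀ / ((n p.1 : ℝ) * (n q.1 : ℝ)) := by
    have hp := hn0 p.1
    have hq := hn0 q.1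
    have e : μ p * μ q = (m₀ / ((n p.1 : ℝ) * (n q.1 : ℝ))) ^ 2 := by
      rw [hμdef]
      field_simp
    rw [e, Real.sqrt_sq (div_nonneg hm.le (mul_nonneg hp.le hq.le))]
  have h2 := hEND.2
  rw [hsqrt] at h2
  have h1θ : 0 < 1 - θ - θ' := by linarith
  have hpq : 0 < (n p.1 : ℝ) * (n q.1 : ℝ) := mul_pos (hn0 p.1) (hn0 q.1)
  calc ‖(cmat Sw + P)⁻¹ p q‖ ≤ Real.exp (-(κ * dd p q)) / ((1 - θ - θ') * (m₀ / ((n p.1 : ℝ) * (n q.1 : ℝ)))) := h2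
    _ = Real.exp (-(κ * dd p q)) * ((n p.1 : ℝ) * (n q.1 : ℝ)) / ((1 - θ - θ') * m₀) := by
        field_simp

/-- **THE SECTIONED OPERATOR WITH A SIGNED `d_n`-LOCAL REMAINDER, BUDGETS DERIVED (MODEL; every domain).**  As `decay_sandwich_add_signed`,
with `P` read off `r β hPsupp hProw hPcol` (file 1's `budgets_of_signedLocal` at `m := min(μ₀,1)`) and the level-free smallness
`β·e^{κr} < min(μ₀,1)`: `‖(cmat (Ω₀·levelOp·Ω₀ + (1 − Ω₀)) + P)⁻¹(p,q)‖ ≤ e^{−κ·d_n(p,q)}·n(p)n(q)∕(min(μ₀,1) − β·e^{κr})`. [folklore] -/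
theorem decay_sandwich_add_signedLocal
    (hdisj : ∀ k k' v v', cellPt S hS hdivS lvl zc k v = cellPt S hS hdivS lvl zc k' v' → k = k')
    (hcover : ∀ x : UT N, ∃ k, ∃ v : Box d (S (lvl k)), cellPt S hS hdivS lvl zc k v = x)
    (Rm : UT N × Fin d → Cp → Cp → ℝ) (hRm : ∀ b i j, ∑ k, Rm b k i * Rm b k j = if i = j then (1 : ℝ) else 0)
    (T : J → UT N → Cp → Cp → ℝ) (hT : ∀ l x i i', ∑ k, T l x k i * T l x k i' = if i = i' then (1 : ℝ) else 0)
    (a : J → ℝ) (ha : ∀ j, 0 ≤ a j) (ω : J → UT N → ℝ)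
    (hsupp : ∀ l x, ω l (ctrU N (S l) (tblk (hS l) (hdivS l) x)) ≠ 0 → ∃ k v, lvl k = l ∧ cellPt S hS hdivS lvl zc k v = x)
    {amax : ℝ} (hamax : 0 ≤ amax)
    (hscale : ∀ k, a (lvl k) * ω (lvl k) (ctrU N (S (lvl k)) (zc k)) ^ 2 * (S (lvl k) : ℝ) ^ d ≤ amax / (S (lvl k) : ℝ) ^ 2)
    (c : UT N × Fin d → ℝ) {cmax : ℝ} (hc : ∀ b, |c b| ≤ cmax) {C : ℝ}
    (hcoer : ∀ f : UT N × Cp → ℝ,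
      C * ∑ k, ((S (lvl k) : ℝ) ^ 2)⁻¹ * ∑ v : Box d (S (lvl k)), ∑ i, f (cellPt S hS hdivS lvl zc k v, i) ^ 2 ≤
        ∑ p, f p * levelOp bsrc btgt c Rm (fun l x => ctrU N (S l) (tblk (hS l) (hdivS l) x))
          (fun l x => ω l (ctrU N (S l) (tblk (hS l) (hdivS l) x))) T a f p)
    {κ : ℝ} (hκ0 : 0 ≤ κ) (hκ1 : κ ≤ 1) (hμ : 0 < C - 2 * d * cmax ^ 2 * κ ^ 2 - amax * (Real.exp (2 * d * κ) - 1))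
    (χ : UT N × Cp → ℝ) (hχ : ∀ p, χ p = 0 ∨ χ p = 1)
    (P : Matrix (UT N × Cp) (UT N × Cp) ℂ) {r β : ℝ} (hr : 0 ≤ r)
    (hPsupp : ∀ e e' : UT N × Cp, P e e' ≠ 0 → sdist bsrc btgt (siteScale S hS hdivS lvl zc hcover) e.1 e'.1 ≤ r)
    (hProw : ∀ e : UT N × Cp, ∑ e', ‖P e e'‖ ≤ β * ((siteScale S hS hdivS lvl zc hcover e.1 : ℝ) ^ 2)⁻¹)
    (hPcol : ∀ e' : UT N × Cp, ∑ e, ‖P e e'‖ ≤ β * ((siteScale S hS hdivS lvl zc hcover e'.1 : ℝ) ^ 2)⁻¹)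
    (hsmall : β * Real.exp (κ * r) < min (C - 2 * d * cmax ^ 2 * κ ^ 2 - amax * (Real.exp (2 * d * κ) - 1)) 1)
    (p q : UT N × Cp) :
    IsUnit (cmat (mulOp χ * levelOp bsrc btgt c Rm (fun l x => ctrU N (S l) (tblk (hS l) (hdivS l) x))
          (fun l x => ω l (ctrU N (S l) (tblk (hS l) (hdivS l) x))) T a * mulOp χ + mulOp (1 - χ) :
        Module.End ℝ (UT N × Cp → ℝ)) + P) ∧
      ‖(cmat (mulOp χ * levelOp bsrc btgt c Rm (fun l x => ctrU N (S l) (tblk (hS l) (hdivS l) x))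
            (fun l x => ω l (ctrU N (S l) (tblk (hS l) (hdivS l) x))) T a * mulOp χ + mulOp (1 - χ) :
          Module.End ℝ (UT N × Cp → ℝ)) + P)⁻¹ p q‖ ≤
        Real.exp (-(κ * sdist bsrc btgt (siteScale S hS hdivS lvl zc hcover) p.1 q.1)) *
          ((siteScale S hS hdivS lvl zc hcover p.1 : ℝ) * (siteScale S hS hdivS lvl zc hcover q.1 : ℝ)) /
          (min (C - 2 * d * cmax ^ 2 * κ ^ 2 - amax * (Real.exp (2 * d * κ) - 1)) 1 - β * Real.exp (κ * r)) := by
  set m₀ := min (C - 2 * d * cmax ^ 2 * κ ^ 2 - amax * (Real.exp (2 * d * κ) - 1)) 1 with hm₀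
  have hm : 0 < m₀ := lt_min hμ zero_lt_one
  obtain ⟨h1θ, hPform, hJ⟩ := budgets_of_signedLocal (siteScale S hS hdivS lvl zc hcover) (one_le_siteScale S hS hdivS lvl zc hcover)
    hm hκ0 P hr hPsupp hProw hPcol
  have hθsum : β * (Real.exp (κ * r) - 1) / m₀ + β / m₀ < 1 := by
    rw [← add_div, div_lt_one hm]
    nlinarith
  have hEND := decay_sandwich_add_signed S hS hdivS lvl zc hdisj hcover Rm hRm T hT a ha ω hsupp hamax hscale c hc hcoer hκ0 hκ1 hμ
    χ hχ P hθsum hPform hJ p q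
  rw [h1θ] at hEND
  exact hEND

end Sandwich

end Summit.QuantumFields.BalabanUV.T4Continuum.ShellMeasureDecaySignedRemainderCov

end
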